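import Literature.Combinatorics.SimpleGraph.TreeRetractionOntoSubtree   -- ★ `TreeRetraction.exists_retraction` (height ∕ parent toward a subtree, equivariance)
import Literature.GroupTheory.OrbitQuotientTubeCount                    -- ★ §1: `natCard_quotient_orbitRel_comap_eq_of_bijective`
import Mathlib.Algebra.Group.Action.Pointwise.Set.Basic
import Mathlib.Tactic.Ring
import HarnessLib

/-!
# Per period of a translation of ANY amplitude along a line, «fixed vertices = pointwise-fixed edges» on a tree acted on WITHOUT inversions:
# the combinatorial heart of Kottwitz's NON-ELLIPTIC Euler–Poincaré relation for a type-preserving action (Kottwitz 1988 §2 Thm. 2; Serre, *Trees* I.6.4)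

Topic `Combinatorics/SimpleGraph`; namespace `Literature.Combinatorics.SimpleGraph.TreeAction`.  THEOREMS ONLY (no definition ∕ instance ∕ notation ∕ named fact ∕ `sorry`);
Mathlib + two ★ files.  Cell `pub/hodgecm-mathlib`, crux H413 = `stmt-HodgeConjecture-24833` (`--supports` lane, helper), LH6 rung-0 residue, CENSUS «EP-G» v1 (F0P3a-p09 (g12)) §5
brick (G1) «(N)-G», TREE SIDE; seat LH6-p03 (g8).  This is the twin of ★ `TreeActionAxisPerPeriod` (F0P2-p02 (g9): ONE orbit of vertices, inversions allowed, the translation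
moves the base vertex to a NEIGHBOUR) for the situation of the quasi-split `U(3)`: its Bruhat–Tits tree is bi-regular with TWO vertex types, the action is type-preserving (no
inversions), and a generator `τ` of the split torus modulo its compact part translates its apartment by TWO edges — so the axis cannot be written `τ^ℤ v₀` with `v₀ ∼ τ v₀`.
Here the axis is any injective LINE `W : ℤ → V` of consecutive neighbours translated by `τ` with an arbitrary amplitude `m` (`τ • W k = W (k + m)`).
HONEST LABEL: count-neutral (pure orbit counting on a tree; nothing printed is asserted); HC_CM is proved only modulo the 7 printed citations (2 remaining named inputs
hLiu418 = stmt-HodgeConjecture-24832, h413 = stmt-HodgeConjecture-24833) until rung 0 closes.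

THE MATHEMATICS.  `Φ` acts on the vertices of a tree `G` by automorphisms and is generated by `τ`; `W : ℤ → V` is injective with `W k ∼ W (k+1)` and `τ • W k = W (k + m)`; `γ`
is an automorphism commuting with `Φ`.  The line `A = W(ℤ)` is `Φ`-invariant and induces a connected subgraph, and in a tree its only internal edges are the consecutive ones
(§1).  (FIXED CASE, §2) If `γ` fixes `A` pointwise, the nearest-point retraction `(h, p)` onto `A` (★ `exists_retraction`) is `γ`- and `Φ`-equivariant, and «fixed vertex `v ↦`
the edge below it» (`{v, p v}` off the line, `{W k, W (k+1)}` for `v = W k` on it) is a `Φ`-equivariant BIJECTION from the `γ`-fixed vertices onto the pointwise `γ`-fixed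
edges; counting `Φ`-orbits («per period»): **`#(fixed vertices ∕ Φ) = #(pointwise-fixed edges ∕ Φ)`**.  (TRANSLATING CASE, §3) If `γ (W k) = W (k + j)` with `j ≠ 0`, the
iterated-parent projection shows that `γ` fixes NO vertex (hence no edge): `0 = 0`.  Orbit counts are typed choice-free as
`Nat.card (Quotient ((MulAction.orbitRel Φ X).comap (Subtype.val : S → X)))` (the currency of ★ `OrbitQuotientTubeCount` and of ★ `TreeActionNonEllipticPerPeriod`); edges are
two-element SETS of vertices under the pointwise action; NO finiteness and NO commutation `γφ = φγ` hypothesis is needed (the bijection is `Φ`-equivariant on all of `V`).  (§0) THE TWO-STEP LINE: from `v₀ ∼ v₁ ∼ τ • v₀` with `τ` free on both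
vertices and `τ^ℤ v₀ ∌ v₁`, the line `W (2n) = τⁿ v₀`, `W (2n+1) = τⁿ v₁` of amplitude `2` — the shape of the apartment of the diagonal torus of `U(3)` through the root
`L₀ = 𝒪³` and its type-two neighbour `N₁`.

* §0 `exists_line_of_two_step` (the amplitude-2 line from `v₀ ∼ v₁ ∼ τ v₀`).
* §1 `exists_path_line`, `line_adj_iff` (in a tree the line is a geodesic: `W a ∼ W b ↔ b = a + 1 ∨ a = b + 1`), `zpow_smul_line`, `smul_mem_line_iff`, `connected_induce_line`.
* §2 **`natCard_quotient_fixed_vertices_eq_fixed_edges_of_line`** (`γ` fixes the line).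
* §3 `forall_ne_of_line_translate` (`γ` translates the line ⇒ no fixed vertex), **`natCard_quotient_fixed_vertices_eq_fixed_edges_of_line_translate`** (`0 = 0`), and both cases
  **`natCard_quotient_fixed_vertices_eq_fixed_edges_of_line_of_exists`**.

## References
* [Kottwitz1988] R. E. Kottwitz, *Tamagawa numbers*, Ann. of Math. 127 (1988), 629–646, §2 Theorem 2 (non-elliptic case: `O_γ(f_EP) = 0`).
* [Serre1980Trees] J.-P. Serre, *Trees*, Springer (1980): I.2.2 Prop. 8 (unique geodesics), I.6.4 Prop. 24–25 (hyperbolic automorphisms, axis, projection), II.1.1.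
* [Laumon1995] G. Laumon, *Cohomology of Drinfeld Modular Varieties* I (1996), Lemma (5.3.2) (orbital integrals as counts of fixed facets modulo the centraliser).
* [Tits1979] J. Tits, *Reductive groups over local fields*, PSPM 33.1 (1979), §2.4 (the quasi-split `²A₂`: two vertex types, no inversions).
-/

set_option autoImplicit false

open SimpleGraph MulAction
open scoped Pointwise

namespace Literature.Combinatorics.SimpleGraph.TreeAction

open Literature.Combinatorics.SimpleGraph Literature.GroupTheory

variable {V : Type*} {G : SimpleGraph V} {Φ : Type*} [Group Φ] [MulAction Φ V]

/-! ## §0 The two-step line `…, v₀, v₁, τ v₀, τ v₁, τ² v₀, …` -/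

section TwoStep

/-- **THE AMPLITUDE-2 LINE.**  If `Φ` acts by automorphisms, `v₀ ∼ v₁ ∼ τ • v₀`, `τ` acts freely on `v₀` and on `v₁` and `v₁ ∉ τ^ℤ v₀`, then `W (2n) = τⁿ v₀`, `W (2n+1) = τⁿ v₁` is an
injective line of consecutive neighbours with `τ • W k = W (k + 2)`, `W 0 = v₀`, `W 1 = v₁` (the apartment of a split torus of the quasi-split `U(3)` through a self-dual vertex
and a type-two neighbour). [cite: Tits1979, §2.4] [cite: Serre1980Trees, I.6.4 Prop. 24] -/
theorem exists_line_of_two_step (hadj : ∀ (φ : Φ) (a b : V), G.Adj (φ • a) (φ • b) ↔ G.Adj a b) (τ : Φ) (v₀ v₁ : V)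
    (h01 : G.Adj v₀ v₁) (h1τ : G.Adj v₁ (τ • v₀)) (hfree₀ : ∀ n : ℤ, τ ^ n • v₀ = v₀ → n = 0) (hfree₁ : ∀ n : ℤ, τ ^ n • v₁ = v₁ → n = 0)
    (hne : ∀ n : ℤ, τ ^ n • v₀ ≠ v₁) :
    ∃ W : ℤ → V, Function.Injective W ∧ (∀ k : ℤ, G.Adj (W k) (W (k + 1))) ∧ (∀ k : ℤ, τ • W k = W (k + 2)) ∧ W 0 = v₀ ∧ W 1 = v₁ := by
  classical
  have hcancel₀ : ∀ a b : ℤ, τ ^ a • v₀ = τ ^ b • v₀ → a = b := fun a b hab => by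
    have h' := congrArg (fun x => τ ^ (-b) • x) hab
    simp only [smul_smul, ← zpow_add, neg_add_cancel, zpow_zero, one_smul] at h'
    have := hfree₀ _ h'
    omega
  have hcancel₁ : ∀ a b : ℤ, τ ^ a • v₁ = τ ^ b • v₁ → a = b := fun a b hab => by
    have h' := congrArg (fun x => τ ^ (-b) • x) hab
    simp only [smul_smul, ← zpow_add, neg_add_cancel, zpow_zero, one_smul] at h'
    have := hfree₁ _ h'
    omega
  refine ⟨fun k => if k % 2 = 0 then τ ^ (k / 2) • v₀ else τ ^ (k / 2) • v₁, ?_, ?_, ?_, ?_, ?_⟩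
  · intro a b hab
    obtain ⟨a', ha⟩ := Int.even_or_odd' a
    obtain ⟨b', hb⟩ := Int.even_or_odd' b
    rcases ha with rfl | rfl <;> rcases hb with rfl | rfl
    · have e1 : (2 * a') % 2 = 0 := by omega
      have e2 : (2 * b') % 2 = 0 := by omega
      have e3 : (2 * a') / 2 = a' := by omega
      have e4 : (2 * b') / 2 = b' := by omega
      simp only [e1, e2, e3, e4, if_true] at hab
      rw [hcancel₀ _ _ hab]
    · have e1 : (2 * a') % 2 = 0 := by omega
      have e2 : (2 * b' + 1) % 2 = 1 := by omega
      have e3 : (2 * a') / 2 = a' := by omega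
      have e4 : (2 * b' + 1) / 2 = b' := by omega
      simp only [e1, e2, e3, e4, if_true, one_ne_zero, if_false] at hab
      have h' := congrArg (fun x => τ ^ (-b') • x) hab
      simp only [smul_smul, ← zpow_add, neg_add_cancel, zpow_zero, one_smul] at h'
      exact (hne _ h').elim
    · have e1 : (2 * a' + 1) % 2 = 1 := by omega
      have e2 : (2 * b') % 2 = 0 := by omega
      have e3 : (2 * a' + 1) / 2 = a' := by omega
      have e4 : (2 * b') / 2 = b' := by omega
      simp only [e1, e2, e3, e4, if_true, one_ne_zero, if_false] at hab
      have h' := congrArg (fun x => τ ^ (-a') • x) hab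
      simp only [smul_smul, ← zpow_add, neg_add_cancel, zpow_zero, one_smul] at h'
      exact (hne _ h'.symm).elim
    · have e1 : (2 * a' + 1) % 2 = 1 := by omega
      have e2 : (2 * b' + 1) % 2 = 1 := by omega
      have e3 : (2 * a' + 1) / 2 = a' := by omega
      have e4 : (2 * b' + 1) / 2 = b' := by omega
      simp only [e1, e2, e3, e4, one_ne_zero, if_false] at hab
      rw [hcancel₁ _ _ hab]
  · intro k
    obtain ⟨n, rfl | rfl⟩ := Int.even_or_odd' k
    · have e1 : (2 * n) % 2 = 0 := by omega
      have e2 : (2 * n + 1) % 2 = 1 := by omega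
      have e3 : (2 * n) / 2 = n := by omega
      have e4 : (2 * n + 1) / 2 = n := by omega
      simp only [e1, e2, e3, e4, if_true, one_ne_zero, if_false]
      exact (hadj _ _ _).2 h01
    · have e1 : (2 * n + 1) % 2 = 1 := by omega
      have e2 : (2 * n + 1 + 1) % 2 = 0 := by omega
      have e3 : (2 * n + 1) / 2 = n := by omega
      have e4 : (2 * n + 1 + 1) / 2 = n + 1 := by omega
      simp only [e1, e2, e3, e4, if_true, one_ne_zero, if_false]
      rw [zpow_add_one, mul_smul]
      exact (hadj _ _ _).2 h1τ
  · intro k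
    have e1 : (k + 2) % 2 = k % 2 := by omega
    have e2 : (k + 2) / 2 = k / 2 + 1 := by omega
    simp only [e1, e2]
    split_ifs
    · rw [zpow_add_one, mul_smul, smul_smul, smul_smul, ← zpow_add_one, ← zpow_one_add, add_comm]
    · rw [zpow_add_one, mul_smul, smul_smul, smul_smul, ← zpow_add_one, ← zpow_one_add, add_comm]
  · simp
  · simp

end TwoStep

/-! ## §1 A line in a tree is a geodesic; invariance and connectedness -/

section Line

/-- **The walk `W k, W (k+1), …, W (k+j)` is a PATH of length `j`** (its vertices are pairwise distinct by injectivity). [cite: Serre1980Trees, I.6.4 Prop. 24] -/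
theorem exists_path_line (W : ℤ → V) (hWinj : Function.Injective W) (hWadj : ∀ k : ℤ, G.Adj (W k) (W (k + 1))) (k : ℤ) (j : ℕ) :
    ∃ p : G.Walk (W k) (W (k + j)), p.IsPath ∧ p.length = j ∧ ∀ u ∈ p.support, ∃ i : ℕ, i ≤ j ∧ u = W (k + i) := by
  induction j generalizing k with
  | zero => exact ⟨(Walk.nil : G.Walk (W k) (W k)).copy rfl (by rw [Nat.cast_zero, add_zero]), by simp, by simp, fun u hu => ⟨0, le_rfl, by simpa using hu⟩⟩
  | succ j ih =>
    obtain ⟨p, hp, hlen, hsupp⟩ := ih (k + 1)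
    let q : G.Walk (W (k + 1)) (W (k + ((j + 1 : ℕ) : ℤ))) := p.copy rfl (by rw [Nat.cast_succ, add_assoc, add_comm (1 : ℤ)])
    have hq : q.IsPath := by simp only [q, Walk.isPath_copy]; exact hp
    have hqsupp : ∀ u ∈ q.support, ∃ i : ℕ, i ≤ j ∧ u = W (k + 1 + i) := fun u hu => by
      simp only [q, Walk.support_copy] at hu
      exact hsupp u hu
    have hnot : W k ∉ q.support := fun h0 => by
      obtain ⟨i, -, hi⟩ := hqsupp _ h0
      have := hWinj hi
      omega
    refine ⟨Walk.cons (hWadj k) q, (Walk.cons_isPath_iff (hWadj k) q).2 ⟨hq, hnot⟩, by simp [q, hlen], fun u hu => ?_⟩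
    rw [Walk.support_cons, List.mem_cons] at hu
    rcases hu with rfl | hu
    · exact ⟨0, Nat.zero_le _, by rw [Nat.cast_zero, add_zero]⟩
    · obtain ⟨i, hi, rfl⟩ := hqsupp u hu
      exact ⟨i + 1, by omega, by rw [Nat.cast_succ, add_assoc, add_comm (1 : ℤ)]⟩

/-- **A LINE IN A TREE IS A GEODESIC**: `W a ∼ W b ↔ b = a + 1 ∨ a = b + 1` (a second adjacency would give two distinct paths between two of its points).
[cite: Serre1980Trees, I.2.2 Prop. 8; I.6.4 Prop. 24] -/
theorem line_adj_iff (hacyc : G.IsAcyclic) (W : ℤ → V) (hWinj : Function.Injective W) (hWadj : ∀ k : ℤ, G.Adj (W k) (W (k + 1))) (a b : ℤ) :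
    G.Adj (W a) (W b) ↔ b = a + 1 ∨ a = b + 1 := by
  have hnat : ∀ (k : ℤ) (j : ℕ), G.Adj (W k) (W (k + j)) → j = 1 := fun k j hj => by
    obtain ⟨p, hp, hlen, -⟩ := exists_path_line W hWinj hWadj k j
    have heq := hacyc.path_unique ⟨p, hp⟩ ⟨hj.toWalk, Walk.IsPath.of_adj hj⟩
    have := congrArg (fun P : G.Path (W k) (W (k + j)) => (P : G.Walk (W k) (W (k + j))).length) heq
    simp only [hlen, Walk.length_cons, Walk.length_nil] at this
    exact this
  constructor
  · intro h
    rcases le_or_gt a b with hab | hab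
    · obtain ⟨j, hj⟩ : ∃ j : ℕ, b = a + j := ⟨(b - a).toNat, by omega⟩
      subst hj
      have := hnat a j h
      left; omega
    · obtain ⟨j, hj⟩ : ∃ j : ℕ, a = b + j := ⟨(a - b).toNat, by omega⟩
      subst hj
      have := hnat b j h.symm
      right; omega
  · rintro (rfl | rfl)
    · exact hWadj a
    · exact (hWadj b).symm

/-- `τ^n • W k = W (k + n m)` for a line translated by `τ` with amplitude `m`. [cite: Serre1980Trees, I.6.4 Prop. 24] -/
theorem zpow_smul_line (τ : Φ) (W : ℤ → V) {m : ℤ} (hW : ∀ k : ℤ, τ • W k = W (k + m)) (n k : ℤ) : τ ^ n • W k = W (k + n * m) := by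
  induction n using Int.induction_on generalizing k with
  | zero => rw [zpow_zero, one_smul, zero_mul, add_zero]
  | succ n ih => rw [zpow_add_one, mul_smul, hW, ih, add_assoc, add_comm m, add_mul, one_mul]
  | pred n ih =>
    have h := ih (k - m)
    rw [show W (k - m) = τ⁻¹ • W k by rw [eq_inv_smul_iff, hW, sub_add_cancel], smul_smul, ← zpow_sub_one] at h
    rw [h, sub_mul, one_mul]
    congr 1
    ring

/-- **The line is `Φ`-invariant** (`Φ = τ^ℤ`). [cite: Serre1980Trees, I.6.4 Prop. 24] -/
theorem smul_mem_line_iff (τ : Φ) (hgen : ∀ φ : Φ, ∃ n : ℤ, τ ^ n = φ) (W : ℤ → V) {m : ℤ} (hW : ∀ k : ℤ, τ • W k = W (k + m)) (φ : Φ) (v : V) :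
    φ • v ∈ Set.range W ↔ v ∈ Set.range W := by
  obtain ⟨n, rfl⟩ := hgen φ
  constructor
  · rintro ⟨k, hk⟩
    refine ⟨k + (-n) * m, ?_⟩
    rw [← zpow_smul_line τ W hW, hk, smul_smul, ← zpow_add, neg_add_cancel, zpow_zero, one_smul]
  · rintro ⟨k, rfl⟩
    exact ⟨k + n * m, (zpow_smul_line τ W hW n k).symm⟩

/-- **The line is connected** (consecutive points are adjacent). [cite: Serre1980Trees, I.6.4 Prop. 24] -/
theorem connected_induce_line (W : ℤ → V) (hWadj : ∀ k : ℤ, G.Adj (W k) (W (k + 1))) : (G.induce (Set.range W)).Connected := by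
  haveI : Nonempty ↥(Set.range W) := ⟨⟨W 0, 0, rfl⟩⟩
  have hreach : ∀ k : ℤ, (G.induce (Set.range W)).Reachable ⟨W 0, 0, rfl⟩ ⟨W k, k, rfl⟩ := fun k => by
    induction k using Int.induction_on with
    | zero => exact ⟨Walk.nil⟩
    | succ k ih =>
      refine ih.trans (Adj.reachable ?_)
      rw [induce_adj]
      exact hWadj k
    | pred k ih =>
      refine ih.trans (Adj.reachable ?_)
      rw [induce_adj]
      have := (hWadj (-(k : ℤ) - 1)).symm
      rw [sub_add_cancel] at this
      exact this
  refine Connected.mk fun a b => ?_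
  obtain ⟨m, hm⟩ := a.2
  obtain ⟨n, hn⟩ := b.2
  have ha : a = ⟨W m, m, rfl⟩ := Subtype.ext hm.symm
  have hb : b = ⟨W n, n, rfl⟩ := Subtype.ext hn.symm
  rw [ha, hb]
  exact (hreach m).symm.trans (hreach n)

end Line

/-! ## §2 Per period: fixed vertices = pointwise-fixed edges (`γ` fixing the line) -/

section Fixed

/-- **PER PERIOD OF THE TRANSLATION, `#(fixed vertices) = #(pointwise-fixed edges)`** for an automorphism `γ` of the tree `G` fixing pointwise a
line `W` of consecutive neighbours translated by `τ` (any amplitude `m`); orbit counts `#(S∕Φ) = Nat.card (Quotient ((orbitRel Φ X).comap Subtype.val))`, edges two-element sets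
under the pointwise action (no finiteness assumed: `Nat.card` on both sides).  Proof: retraction `(h, p)` onto the line (★ `exists_retraction`) and the `Φ`-equivariant bijection «fixed vertex
`↦` the edge below it» (`{v, p v}` off the line, `{W k, W (k+1)}` on it). [cite: Kottwitz1988, §2 Theorem 2] [cite: Serre1980Trees, I.6.4 Prop. 24–25] [cite: Laumon1995, Lemma (5.3.2)] -/
theorem natCard_quotient_fixed_vertices_eq_fixed_edges_of_line (hT : G.IsTree)
    (hadj : ∀ (φ : Φ) (a b : V), G.Adj (φ • a) (φ • b) ↔ G.Adj a b) (τ : Φ) (hgen : ∀ φ : Φ, ∃ n : ℤ, τ ^ n = φ)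
    (W : ℤ → V) (hWinj : Function.Injective W) (hWadj : ∀ k : ℤ, G.Adj (W k) (W (k + 1))) {m : ℤ} (hW : ∀ k : ℤ, τ • W k = W (k + m))
    (γ : V ≃ V) (hγadj : ∀ a b : V, G.Adj (γ a) (γ b) ↔ G.Adj a b) (hγW : ∀ k : ℤ, γ (W k) = W k) :
    Nat.card (Quotient ((MulAction.orbitRel Φ V).comap (Subtype.val : {v : V | γ v = v} → V))) =
      Nat.card (Quotient ((MulAction.orbitRel Φ (Set V)).comap
        (Subtype.val : {s : Set V | ∃ a b : V, G.Adj a b ∧ s = {a, b} ∧ γ a = a ∧ γ b = b} → Set V))) := by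
  classical
  set Y : Set V := Set.range W with hY
  set FV : Set V := {v : V | γ v = v} with hFV
  set FE : Set (Set V) := {s : Set V | ∃ a b : V, G.Adj a b ∧ s = {a, b} ∧ γ a = a ∧ γ b = b} with hFE
  /- (0) the line -/
  have hYΦ : ∀ (φ : Φ) (v : V), φ • v ∈ Y ↔ v ∈ Y := smul_mem_line_iff τ hgen W hW
  have hYγ : ∀ y ∈ Y, γ y = y := by
    rintro _ ⟨k, rfl⟩
    exact hγW k
  have hline := line_adj_iff hT.isAcyclic W hWinj hWadj
  -- the successor along the line: `s (W k) = W (k + 1)` (by choice of the index, unique by injectivity)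
  have hidx : ∀ y ∈ Y, ∃ k : ℤ, W k = y := fun y hy => hy
  let idx : V → ℤ := fun y => if hy : y ∈ Y then Classical.choose (hidx y hy) else 0
  have hidx_spec : ∀ k : ℤ, idx (W k) = k := fun k => by
    have hy : W k ∈ Y := ⟨k, rfl⟩
    have h1 : W (idx (W k)) = W k := by
      simp only [idx, dif_pos hy]
      exact Classical.choose_spec (hidx (W k) hy)
    exact hWinj h1
  let s : V → V := fun y => W (idx y + 1)
  have hs : ∀ k : ℤ, s (W k) = W (k + 1) := fun k => by simp only [s, hidx_spec]
  have hsY : ∀ y ∈ Y, s y ∈ Y := fun y _ => ⟨_, rfl⟩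
  have hs_adj : ∀ y ∈ Y, G.Adj y (s y) := by
    rintro _ ⟨k, rfl⟩
    rw [hs]; exact hWadj k
  have hs_smul : ∀ (φ : Φ) (y : V), y ∈ Y → s (φ • y) = φ • s y := by
    rintro φ _ ⟨k, rfl⟩
    obtain ⟨n, rfl⟩ := hgen φ
    rw [zpow_smul_line τ W hW, hs, hs, zpow_smul_line τ W hW]
    congr 1; ring
  have hs2 : ∀ y ∈ Y, s (s y) ≠ y := by
    rintro _ ⟨k, rfl⟩ h2
    rw [hs k, hs (k + 1)] at h2
    have := hWinj h2
    omega
  have hs_inj : ∀ y ∈ Y, ∀ y' ∈ Y, s y = s y' → y = y' := by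
    rintro _ ⟨k, rfl⟩ _ ⟨k', rfl⟩ h
    rw [hs, hs] at h
    have := hWinj h
    rw [show k = k' by omega]
  /- (1) the retraction onto the line and its equivariance -/
  obtain ⟨h, p, -, hzero, hpar, hedge, -, hequi⟩ :=
    TreeRetraction.exists_retraction hT (Y := Y) ⟨W 0, 0, rfl⟩ (connected_induce_line W hWadj)
  have hequiΦ : ∀ (φ : Φ) (v : V), h (φ • v) = h v ∧ (v ∉ Y → p (φ • v) = φ • p v) := fun φ v =>
    hequi ({ toEquiv := MulAction.toPerm φ, map_rel_iff' := fun {a b} => hadj φ a b } : G ≃g G) (fun v => hYΦ φ v) v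
  have hYγiff : ∀ v : V, γ v ∈ Y ↔ v ∈ Y := fun v =>
    ⟨fun hv => by rwa [← γ.injective (hYγ _ hv)], fun hv => by rwa [hYγ v hv]⟩
  have hequiγ : ∀ v : V, h (γ v) = h v ∧ (v ∉ Y → p (γ v) = γ (p v)) := fun v =>
    hequi ({ toEquiv := γ, map_rel_iff' := fun {a b} => hγadj a b } : G ≃g G) hYγiff v
  /- (2) the bijection «fixed vertex ↦ the edge below it» -/
  let fval : V → Set V := fun v => if v ∈ Y then {v, s v} else {v, p v}
  have hfval_Y : ∀ v ∈ Y, fval v = {v, s v} := fun v hv => if_pos hv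
  have hfval_off : ∀ v ∉ Y, fval v = {v, p v} := fun v hv => if_neg hv
  have hfval_mem : ∀ v ∈ FV, fval v ∈ FE := fun v hv => by
    by_cases hvY : v ∈ Y
    · rw [hfval_Y v hvY]
      exact ⟨_, _, hs_adj v hvY, rfl, hYγ v hvY, hYγ _ (hsY v hvY)⟩
    · rw [hfval_off v hvY]
      refine ⟨_, _, (hpar v hvY).1, rfl, hv, ?_⟩
      rw [← (hequiγ v).2 hvY, show γ v = v from hv]
  have hfval_smul : ∀ (φ : Φ) (v : V), fval (φ • v) = φ • fval v := fun φ v => by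
    by_cases hvY : v ∈ Y
    · rw [hfval_Y v hvY, hfval_Y _ ((hYΦ φ v).2 hvY), Set.smul_set_insert, Set.smul_set_singleton, hs_smul φ v hvY]
    · rw [hfval_off v hvY, hfval_off _ (fun h' => hvY ((hYΦ φ v).1 h')), Set.smul_set_insert, Set.smul_set_singleton, (hequiΦ φ v).2 hvY]
  have hfval_inj : ∀ v w : V, fval v = fval w → v = w := fun v w hvw => by
    by_cases hvY : v ∈ Y <;> by_cases hwY : w ∈ Y
    · rw [hfval_Y v hvY, hfval_Y w hwY, Set.pair_eq_pair_iff] at hvw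
      rcases hvw with ⟨hvw, -⟩ | ⟨h1, h2⟩
      · exact hvw
      · exact (hs2 w hwY (by rw [← h1, h2])).elim
    · rw [hfval_Y v hvY, hfval_off w hwY, Set.pair_eq_pair_iff] at hvw
      rcases hvw with ⟨h1, -⟩ | ⟨-, h2⟩
      · exact (hwY (h1 ▸ hvY)).elim
      · exact (hwY (h2 ▸ hsY v hvY)).elim
    · rw [hfval_off v hvY, hfval_Y w hwY, Set.pair_eq_pair_iff] at hvw
      rcases hvw with ⟨h1, -⟩ | ⟨h1, -⟩
      · exact (hvY (h1 ▸ hwY)).elim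
      · exact (hvY (h1 ▸ hsY w hwY)).elim
    · rw [hfval_off v hvY, hfval_off w hwY, Set.pair_eq_pair_iff] at hvw
      rcases hvw with ⟨hvw, -⟩ | ⟨h1, h2⟩
      · exact hvw
      · have h3 := (hpar v hvY).2
        have h4 := (hpar w hwY).2
        rw [h2] at h3
        rw [← h1] at h4
        omega
  have hfval_surj : ∀ t ∈ FE, ∃ v ∈ FV, fval v = t := by
    rintro _ ⟨a, b, hab, rfl, hγa, hγb⟩
    by_cases hab' : a ∈ Y ∧ b ∈ Y
    · obtain ⟨⟨ka, rfl⟩, ⟨kb, rfl⟩⟩ := hab'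
      rcases (hline ka kb).1 hab with rfl | rfl
      · exact ⟨_, hγa, by rw [hfval_Y _ ⟨ka, rfl⟩, hs]⟩
      · exact ⟨_, hγb, by rw [hfval_Y _ ⟨kb, rfl⟩, hs, Set.pair_comm]⟩
    · rcases hedge a b hab hab' with ⟨haY, hpa⟩ | ⟨hbY, hpb⟩
      · exact ⟨a, hγa, by rw [hfval_off a haY, hpa]⟩
      · exact ⟨b, hγb, by rw [hfval_off b hbY, hpb, Set.pair_comm]⟩
  let f : FV → FE := fun v => ⟨fval v, hfval_mem v v.2⟩
  have hf : Function.Bijective f := by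
    refine ⟨fun v w hvw => Subtype.ext (hfval_inj _ _ (congrArg Subtype.val hvw)), fun t => ?_⟩
    obtain ⟨v, hv, hvs⟩ := hfval_surj t.1 t.2
    exact ⟨⟨v, hv⟩, Subtype.ext hvs⟩
  exact (natCard_quotient_orbitRel_comap_eq_of_bijective (Φ := Φ) FV FE f hf fun u t => by
    constructor
    · rintro ⟨φ, hφ⟩
      exact ⟨φ, by rw [show ((f t : FE) : Set V) = fval t from rfl, show ((f u : FE) : Set V) = fval u from rfl, ← hfval_smul, hφ]⟩
    · rintro ⟨φ, hφ⟩
      rw [show ((f t : FE) : Set V) = fval t from rfl, show ((f u : FE) : Set V) = fval u from rfl, ← hfval_smul] at hφ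
      exact ⟨φ, hfval_inj _ _ hφ⟩).1

end Fixed

/-! ## §3 The translating case: no fixed vertex, `0 = 0`; both cases -/

section Translate

/-- **An automorphism `γ` commuting with `Φ = τ^ℤ` and TRANSLATING the line (`γ (W k) = W (k + j)`, `j ≠ 0`) fixes no vertex**: the iterated-parent projection of a fixed
vertex onto the line would be a fixed vertex of the line. [cite: Serre1980Trees, I.6.4 Prop. 25] -/
theorem forall_ne_of_line_translate (hT : G.IsTree) (W : ℤ → V) (hWinj : Function.Injective W) (hWadj : ∀ k : ℤ, G.Adj (W k) (W (k + 1)))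
    (γ : V ≃ V) (hγadj : ∀ a b : V, G.Adj (γ a) (γ b) ↔ G.Adj a b)
    {j : ℤ} (hγW : ∀ k : ℤ, γ (W k) = W (k + j)) (hj : j ≠ 0) (v : V) : γ v ≠ v := by
  classical
  set Y : Set V := Set.range W with hY
  -- `γ` maps the line onto itself (translating it by `j`)
  have hγY : ∀ v : V, γ v ∈ Y ↔ v ∈ Y := fun v => by
    constructor
    · rintro ⟨k, hk⟩
      have h1 : γ (W (k - j)) = γ v := by rw [hγW, sub_add_cancel, hk]
      exact ⟨k - j, γ.injective h1⟩
    · rintro ⟨k, rfl⟩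
      exact ⟨k + j, (hγW k).symm⟩
  obtain ⟨h, p, -, hzero, hpar, -, -, hequi⟩ :=
    TreeRetraction.exists_retraction hT (Y := Y) ⟨W 0, 0, rfl⟩ (connected_induce_line W hWadj)
  have hequiγ : ∀ v : V, h (γ v) = h v ∧ (v ∉ Y → p (γ v) = γ (p v)) := fun v =>
    hequi ({ toEquiv := γ, map_rel_iff' := fun {a b} => hγadj a b } : G ≃g G) hγY v
  -- the iterated parent: height bookkeeping and `γ`-equivariance
  have hiter : ∀ (i : ℕ) (v : V), i ≤ h v → h (p^[i] v) + i = h v ∧ γ (p^[i] v) = p^[i] (γ v) := by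
    intro i
    induction i with
    | zero => intro v _; exact ⟨by rw [Function.iterate_zero, id, add_zero], by rw [Function.iterate_zero, id, id]⟩
    | succ i ih =>
      intro v hi
      obtain ⟨h1, h2⟩ := ih v (by omega)
      have hnotY : p^[i] v ∉ Y := fun hiY => by
        have := (hzero _).2 hiY
        omega
      rw [Function.iterate_succ_apply', Function.iterate_succ_apply']
      refine ⟨by have := (hpar _ hnotY).2; omega, ?_⟩
      rw [← (hequiγ _).2 hnotY, h2]
  intro hv
  obtain ⟨hy1, hy2⟩ := hiter (h v) v le_rfl
  obtain ⟨k, hk⟩ : p^[h v] v ∈ Y := (hzero _).1 (by omega)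
  rw [hv] at hy2
  -- `γ (W k) = W (k + j)` but `γ` fixes `p^[h v] v = W k`
  have h3 : W (k + j) = W k := by rw [← hγW, hk, hy2]
  have := hWinj h3
  omega

/-- **PER PERIOD, `0 = 0` IN THE TRANSLATING CASE**: if `γ (W k) = W (k + j)` with `j ≠ 0` then `γ` fixes no vertex and no edge, so both per-period counts vanish.
[cite: Kottwitz1988, §2 Theorem 2] [cite: Serre1980Trees, I.6.4 Prop. 25] -/
theorem natCard_quotient_fixed_vertices_eq_fixed_edges_of_line_translate (hT : G.IsTree) (W : ℤ → V) (hWinj : Function.Injective W)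
    (hWadj : ∀ k : ℤ, G.Adj (W k) (W (k + 1))) (γ : V ≃ V) (hγadj : ∀ a b : V, G.Adj (γ a) (γ b) ↔ G.Adj a b)
    {j : ℤ} (hγW : ∀ k : ℤ, γ (W k) = W (k + j)) (hj : j ≠ 0) :
    Nat.card (Quotient ((MulAction.orbitRel Φ V).comap (Subtype.val : {v : V | γ v = v} → V))) =
      Nat.card (Quotient ((MulAction.orbitRel Φ (Set V)).comap
        (Subtype.val : {s : Set V | ∃ a b : V, G.Adj a b ∧ s = {a, b} ∧ γ a = a ∧ γ b = b} → Set V))) := by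
  have hno := forall_ne_of_line_translate hT W hWinj hWadj γ hγadj hγW hj
  haveI : IsEmpty {v : V | γ v = v} := ⟨fun v => hno v.1 v.2⟩
  haveI : IsEmpty {s : Set V | ∃ a b : V, G.Adj a b ∧ s = {a, b} ∧ γ a = a ∧ γ b = b} := ⟨fun s => by
    obtain ⟨a, b, -, -, hγa, -⟩ := s.2
    exact hno a hγa⟩
  rw [Nat.card_of_isEmpty, Nat.card_of_isEmpty]

/-- **PER PERIOD, `#(fixed vertices) = #(pointwise-fixed edges)`, both cases** (`γ` commuting with `Φ`, `γ (W k) = W (k + j)` for some `j`: `j = 0` fixed line, `j ≠ 0` translating).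
[cite: Kottwitz1988, §2 Theorem 2] [cite: Serre1980Trees, I.6.4 Prop. 24–25] [cite: Laumon1995, Lemma (5.3.2)] -/
theorem natCard_quotient_fixed_vertices_eq_fixed_edges_of_line_of_exists (hT : G.IsTree)
    (hadj : ∀ (φ : Φ) (a b : V), G.Adj (φ • a) (φ • b) ↔ G.Adj a b) (τ : Φ) (hgen : ∀ φ : Φ, ∃ n : ℤ, τ ^ n = φ)
    (W : ℤ → V) (hWinj : Function.Injective W) (hWadj : ∀ k : ℤ, G.Adj (W k) (W (k + 1))) {m : ℤ} (hW : ∀ k : ℤ, τ • W k = W (k + m))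
    (γ : V ≃ V) (hγadj : ∀ a b : V, G.Adj (γ a) (γ b) ↔ G.Adj a b) (hγW : ∃ j : ℤ, ∀ k : ℤ, γ (W k) = W (k + j)) :
    Nat.card (Quotient ((MulAction.orbitRel Φ V).comap (Subtype.val : {v : V | γ v = v} → V))) =
      Nat.card (Quotient ((MulAction.orbitRel Φ (Set V)).comap
        (Subtype.val : {s : Set V | ∃ a b : V, G.Adj a b ∧ s = {a, b} ∧ γ a = a ∧ γ b = b} → Set V))) := by
  obtain ⟨j, hj⟩ := hγW
  by_cases hj0 : j = 0
  · subst hj0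
    simp only [add_zero] at hj
    exact natCard_quotient_fixed_vertices_eq_fixed_edges_of_line hT hadj τ hgen W hWinj hWadj hW γ hγadj hj
  · exact natCard_quotient_fixed_vertices_eq_fixed_edges_of_line_translate hT W hWinj hWadj γ hγadj hj hj0

end Translate

end Literature.Combinatorics.SimpleGraph.TreeAction
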